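import Mathlib.Analysis.Calculus.ContDiff.Basic
import Mathlib.MeasureTheory.Function.Jacobian
import Literature.StrongHypotheses.KontsevichZagierPeriods
import Literature.NumberTheory.Transcendental.KZCalculusProofs
import Literature.NumberTheory.Transcendental.KZKernelConjectureForms
import Literature.NumberTheory.Transcendental.KZVolumeConjectureProofs
import Literature.NumberTheory.Transcendental.KZLogCalculusProofs
import HarnessLib

/-!
# The GKZ-conjecture implies the KZ-conjecture (Cresson–Viu-Sos 2022, (1.3) and Thm. 2.1)

Proof file for the PRINTED implication between the geometric Kontsevich–Zagier conjecture
`Literature.StrongHypotheses.KontsevichZagierPeriods.GKZConjecture` (Cresson–Viu-Sos 2022,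
Conj. 1.1: `vol : K₀(CSA_{ℝalg}) → ℝ` is injective, stated in the registry
`Literature/StrongHypotheses/KontsevichZagierPeriods.lean` over the free abelian group `GKZGroup` on
compact top-dimensional `ℚ`-semialgebraic sets and the GKZ-rules (2.3), (2.4), (2.6)) and
Conjecture 1 of Kontsevich–Zagier over the calculus of moves of `KZCalculus.lean`, in its three
in-tree forms: the volume form `KZ.volumeConjectureCompact` (`KZVolumeConjecture.lean`), the
two-representation form `KZPeriodConjecture'` and the literal (`IsRational`-endpoint) form of
[Kontsevich–Zagier 2001, §1.2, Conjecture 1] (`KZKernelConjectureForms.lean`). Theorems and three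
auxiliary definitions (`CressonViuSos.volRep`, `CressonViuSos.toKZ`, `CressonViuSos.iterSlab`); no
named fact is introduced.

Source read: J. Cresson, J. Viu-Sos, *On the equality of periods of Kontsevich–Zagier*, J. Théor.
Nombres Bordeaux 34 (2022) 323–343 (`lit read 10.5802/jtnb.1204`, materialised pp. 5, 8–10 =
printed pp. 326, 329–331). Printed statement and proof, verbatim: "(1.3) GKZ ⟹ KZ" (p. 326: "The
geometric operations involved in the GKZ-conjecture, called the GKZ-rules in the following, are
compatible by definition with the KZ-rules. As a consequence, we have the following relation
between the two conjectures") and "Theorem 2.1. The GKZ-conjecture implies the KZ-conjecture."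
(p. 331: "From the previous discussions and the fact that any integral representation of a
non-zero period can be algorithmically reduced to the volume of a compact semi-algebraic set (up to
sign), one has the following implication.") — i.e. (a) each GKZ-rule (2.3), (2.4), (2.6) of §2.2
is an instance of KZ's rules 1)–3), and (b) Viu-Sos' semi-canonical reduction
[Viu-Sos 2021, Thm. 1.1]. The formal proof follows exactly this architecture:

* (a) `CressonViuSos.toKZ : GKZGroup →+ KZ.FormalRep`, `[K] ↦ [I(K, 1)]` (`CressonViuSos.volRep`,
  integrand `1`, integrable since `K` is compact), maps the GKZ-rules into `KZ.relations`
  (`CressonViuSos.gkzRelations_le_comap`):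
  - scissors congruences (2.3) are literally domain-additivity moves (1a) (`KZ.domainAddRel`; the
    side condition `vol(K ∩ K') = 0` is the one of the move);
  - volume-preserving algebraic maps (2.4) are change-of-variables moves (2)
    (`KZ.changeOfVariablesRel` with `Φ = f`, `Φ' = fderiv ℝ f`, `|det| = |1| = 1`; `f` is
    differentiable at the points of the open `U ⊇ K` since it is `C¹` there);
  - the flattening relation (2.6) `[K × Iⁿ] = [K]` is `n` Newton–Leibniz moves (3): `K × Iⁿ` is
    the `n`-th iterated unit slab over `K` (`CressonViuSos.iterSlab`, by `KZ.IntegralRep.slab` of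
    `KZCalculusProofs.lean`, one move each, `KZ.IntegralRep.equivalent_slab`).
  As a by-product the GKZ-rules are sound, `gkzRelations ≤ ker vol`
  (`CressonViuSos.gkzRelations_le_ker_gkzVol`; "we extend naturally the volume … into a
  well-defined ring morphism `vol : K₀(CSA_{ℝalg}) → ℝ`", p. 330), left unproved in the registry.
* (b) is in the tree as the discharged facts `KZ.semiCanonicalReduction_holds` and
  `KZ.kzPeriodConjecture'_iff_volumeConjectureCompact_holds` (`KZVolumeConjectureProofs.lean`).
  So it suffices to derive the volume form from `GKZConjecture`
  (`CressonViuSos.volumeConjectureCompact_of_gkzConjecture`): two integrand-`1` representations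
  `r`, `r'` on compact top-dimensional domains `K`, `K' ⊆ ℝ^d` with `vol K = vol K'` give
  `vol ([K] − [K']) = 0`, hence `[K] − [K'] ∈ gkzRelations` by GKZ, hence
  `[I(K, 1)] − [I(K', 1)] ∈ KZ.relations` by (a); and `[r] ≡ [I(K, 1)]` by integrand congruence
  (`KZ.of_sub_of_mem_relations_of_eqOn`). The point `d = 0` (excluded from `CSA`, Rem. 2.2 (2)) is
  settled by congruence alone: both domains are the one-point space `ℝ⁰`.

The summit-side bridge `Summit.KontsevichZagierPeriods.StrongHypotheses.GKZConjectureImpliesKontsevichZagierPeriods`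
(`Summits/KontsevichZagierPeriods/StrongHypotheses.lean`) is then the one-liner
`fun h => volumeConjectureCompact_iff_kontsevichZagierPeriods.mp
(CressonViuSos.volumeConjectureCompact_of_gkzConjecture h)` (equivalently
`KontsevichZagierPeriods_iff.mpr (CressonViuSos.gkzConjecture_implies_conjectureOne h)`), to be
placed in `Summits/KontsevichZagierPeriods/KontsevichZagierPeriods/Theorems/` (prover-only tree).

## References

* [CressonViusos2022] J. Cresson, J. Viu-Sos, JTNB 34 (2022) 323–343: §1 (p. 326, (1.3)),
  §2.2 (pp. 329–330, (2.2)–(2.6), `vol`), Thm. 2.1 (p. 331).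
* [ViuSos2021] J. Viu-Sos, IJNT 17 (2021) 147–174, Thm. 1.1 (in tree: `KZ.semiCanonicalReduction_holds`).
* [KontsevichZagier2001] M. Kontsevich, D. Zagier, *Periods*, Springer (2001), §1.2, Conjecture 1.
-/

noncomputable section

namespace Literature.NumberTheory.Transcendental

namespace CressonViuSos

open _root_.MeasureTheory _root_.Set
open Literature.NumberTheory.Transcendental.KZ
open Literature.StrongHypotheses.KontsevichZagierPeriods
open Literature.ModelTheory.ExponentialFields (IsSemialgebraic)

variable {d : ℕ}

/-! ### (a) The GKZ-rules are instances of the KZ-rules -/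

/-- The volume representation `I(K, 1) = ∫_K 1` of a compact top-dimensional `ℚ`-semialgebraic
set `K ⊆ ℝ^d` (integrand `1`; absolutely integrable since a compact set has finite Lebesgue
measure). [cite: CressonViusos2022, §1 p. 325 (I(K,1) = vol_d(K))] -/
def volRep (K : Set (Fin d → ℝ)) (hK : IsCSA d K) : IntegralRep d where
  domain := K
  integrand := fun _ => 1
  isSemialgebraic_domain := hK.isSemialgebraic
  isSemialgebraicFunOn_integrand := by
    simpa using isSemialgebraicFunOn_aeval hK.isSemialgebraic (1 : MvPolynomial (Fin d) ℚ)
  integrableOn := integrableOn_const (hs := hK.isCompact.measure_lt_top.ne)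

/-- The domain of `I(K, 1)` is `K`. [cite: CressonViusos2022, §1 p. 325] -/
@[simp] theorem volRep_domain (K : Set (Fin d → ℝ)) (hK : IsCSA d K) :
    (volRep K hK).domain = K := rfl

/-- The integrand of `I(K, 1)` is `1`. [cite: CressonViusos2022, §1 p. 325] -/
@[simp] theorem volRep_integrand (K : Set (Fin d → ℝ)) (hK : IsCSA d K) :
    (volRep K hK).integrand = fun _ => 1 := rfl

/-- The value of a representation with integrand `1` on its domain is the volume of the domain.
[folklore] -/
theorem value_eq_volume_of_integrand_eq_one (r : IntegralRep d)
    (h1 : ∀ x ∈ r.domain, r.integrand x = 1) : r.value = (volume r.domain).toReal := by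
  have hEq : EqOn r.integrand (fun _ => (1 : ℝ)) r.domain := fun x hx => h1 x hx
  rw [IntegralRep.value, setIntegral_congr_fun (IntegralRep.measurableSet_domain_holds r) hEq,
    setIntegral_const, smul_eq_mul, mul_one, measureReal_def]

/-- `value I(K, 1) = vol_d(K)`. [cite: CressonViusos2022, §2.2 (p. 330, vol([K]) = vol_d(K))] -/
theorem value_volRep (K : Set (Fin d → ℝ)) (hK : IsCSA d K) :
    (volRep K hK).value = (volume K).toReal :=
  value_eq_volume_of_integrand_eq_one _ fun _ _ => rfl

/-- The comparison morphism `[K] ↦ [I(K, 1)]` from the free abelian group on `CSA_{ℝalg}` to the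
formal group of integral representations of the KZ calculus. [cite: CressonViusos2022, §1 p. 326 ((1.3))] -/
def toKZ : GKZGroup →+ FormalRep :=
  FreeAbelianGroup.lift fun K : CSA => KZ.of (volRep K.2.1 K.2.2)

/-- `toKZ [K] = [I(K, 1)]`. [cite: CressonViusos2022, §1 p. 326] -/
@[simp] theorem toKZ_csaOf (K : Set (Fin d → ℝ)) (hK : IsCSA d K) :
    toKZ (csaOf K hK) = KZ.of (volRep K hK) :=
  FreeAbelianGroup.lift_apply_of _ _

/-- `vol = eval ∘ toKZ` on generators: the GKZ volume of `[K]` is the value of `I(K, 1)`.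
[cite: CressonViusos2022, §2.2 (p. 330)] -/
theorem eval_toKZ_csaOf (K : Set (Fin d → ℝ)) (hK : IsCSA d K) :
    eval (toKZ (csaOf K hK)) = gkzVol (csaOf K hK) := by
  rw [toKZ_csaOf, eval_of, value_volRep, gkzVol_csaOf]

/-- `vol = eval ∘ toKZ`. [cite: CressonViusos2022, §2.2 (p. 330)] -/
theorem eval_comp_toKZ : eval.comp toKZ = gkzVol := by
  ext K
  obtain ⟨d, K, hK⟩ := K
  exact eval_toKZ_csaOf K hK

/-- **Scissors congruences (2.3) are domain-additivity moves (1a).** [cite: CressonViusos2022, §2.2 (2.3)] -/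
theorem toKZ_mem_relations_of_mem_scissorsRel {x : GKZGroup} (hx : x ∈ scissorsRel) :
    toKZ x ∈ relations := by
  obtain ⟨d, K, K', hK, hK', hU, h0, rfl⟩ := hx
  rw [map_sub, map_sub, toKZ_csaOf, toKZ_csaOf, toKZ_csaOf]
  exact domainAddRel_subset_relations
    ⟨d, volRep (K ∪ K') hU, volRep K hK, volRep K' hK', rfl, h0, fun _ _ => rfl, fun _ _ => rfl, rfl⟩

/-- **Algebraic volume-preserving maps (2.4) are change-of-variables moves (2)**: `f` is
`ℚ`-semialgebraic and injective on `K ⊆ U`, differentiable at every point of the open set `U`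
(being `C¹` there) with `|det f'(x)| = |1| = 1`, so `∫_K 1 = ∫_{f(K)} 1` is one instance of rule (2).
[cite: CressonViusos2022, §2.2 (2.4)] -/
theorem toKZ_mem_relations_of_mem_volumePreservingRel {x : GKZGroup}
    (hx : x ∈ volumePreservingRel) : toKZ x ∈ relations := by
  obtain ⟨d, K, U, f, hK, hfK, hUo, -, hKU, hfs, hinj, hdiff, hdet, rfl⟩ := hx
  rw [map_sub, toKZ_csaOf, toKZ_csaOf]
  refine changeOfVariablesRel_subset_relations
    ⟨d, volRep K hK, volRep (f '' K) hfK, f, fun x => fderiv ℝ f x,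
      hfs.mono hKU hK.isSemialgebraic, ?_, hinj.mono hKU, rfl, ?_, rfl⟩
  · intro x hx
    have hdx : DifferentiableAt ℝ f x :=
      (hdiff.differentiableOn one_ne_zero).differentiableAt (hUo.mem_nhds (hKU hx))
    exact hdx.hasFDerivAt.hasFDerivWithinAt
  · intro x hx
    show (1 : ℝ) = 1 * |(fderiv ℝ f x).det|
    rw [hdet x (hKU hx), abs_one, mul_one]

/-- The `n`-th iterated unit slab `R × [0, 1]ⁿ` of a representation `R` (the unit-interval
coordinates appended last, one `KZ.IntegralRep.slab` at level `0` at a time).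
[cite: CressonViusos2022, §2.2 (2.6)] -/
def iterSlab (R : IntegralRep d) : (n : ℕ) → IntegralRep (d + n)
  | 0 => R
  | n + 1 => (iterSlab R n).slab 0

/-- `R` is KZ-equivalent to each of its iterated slabs (`n` Newton–Leibniz moves).
[cite: CressonViusos2022, §2.2 (2.6)] -/
theorem equivalent_iterSlab (R : IntegralRep d) : ∀ n : ℕ, Equivalent R (iterSlab R n)
  | 0 => Equivalent.refl R
  | n + 1 => (equivalent_iterSlab R n).trans ((iterSlab R n).equivalent_slab 0)

/-- The iterated slabs of an integrand-`1` representation have integrand `1`.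
[cite: CressonViusos2022, §2.2 (2.6)] -/
theorem iterSlab_integrand (R : IntegralRep d) (h : R.integrand = fun _ => 1) :
    ∀ n : ℕ, (iterSlab R n).integrand = fun _ => 1
  | 0 => h
  | n + 1 => by
    funext z
    show (iterSlab R n).integrand (Fin.init z) = 1
    rw [iterSlab_integrand R h n]

/-- The domain of the `n`-th iterated slab over `I(K, 1)` is the cylinder `K × Iⁿ` of the
flattening relation. [cite: CressonViusos2022, §2.2 (2.6)] -/
theorem iterSlab_domain (K : Set (Fin d → ℝ)) (hK : IsCSA d K) :
    ∀ n : ℕ, (iterSlab (volRep K hK) n).domain = cylinder K n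
  | 0 => by
    ext z
    have hz : (fun i : Fin d => z (Fin.castAdd 0 i)) = z := funext fun i => congrArg z (Fin.ext rfl)
    simp only [cylinder, mem_setOf_eq, hz, IsEmpty.forall_iff, and_true]
    rfl
  | n + 1 => by
    have ih := iterSlab_domain K hK n
    ext z
    -- stated fibrewise (the two sides live over the defeq types `Fin (d + n + 1)`, `Fin (d + (n + 1))`,
    -- which `simp` does not identify); all identifications below are definitional
    show Fin.init z ∈ (iterSlab (volRep K hK) n).domain ∧ ((0 : ℕ) : ℝ) ≤ z (Fin.last (d + n)) ∧
        z (Fin.last (d + n)) ≤ ((0 : ℕ) : ℝ) + 1 ↔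
      (fun i : Fin d => z (Fin.castAdd (n + 1) i)) ∈ K ∧
        ∀ j : Fin (n + 1), z (Fin.natAdd d j) ∈ Icc (0 : ℝ) 1
    rw [ih]
    simp only [Nat.cast_zero, zero_add]
    constructor
    · rintro ⟨⟨hzK, hzI⟩, h0, h1⟩
      exact ⟨hzK, Fin.lastCases (motive := fun j : Fin (n + 1) => z (Fin.natAdd d j) ∈ Icc (0 : ℝ) 1)
        ⟨h0, h1⟩ fun j => hzI j⟩
    · rintro ⟨hzK, hzI⟩
      exact ⟨⟨hzK, fun j => hzI (Fin.castSucc j)⟩, (hzI (Fin.last n)).1, (hzI (Fin.last n)).2⟩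

/-- Two integral representations with the same domain and the same integrand are equal.
[folklore] -/
theorem integralRep_eq {n : ℕ} {r r' : IntegralRep n} (h1 : r.domain = r'.domain)
    (h2 : r.integrand = r'.integrand) : r = r' := by
  obtain ⟨σ, f, _, _, _⟩ := r
  obtain ⟨σ', f', _, _, _⟩ := r'
  simp only at h1 h2
  subst h1 h2
  rfl

/-- `I(K × Iⁿ, 1)` IS the `n`-th iterated slab over `I(K, 1)`. [cite: CressonViusos2022, §2.2 (2.6)] -/
theorem volRep_cylinder_eq_iterSlab (K : Set (Fin d → ℝ)) (hK : IsCSA d K) (n : ℕ)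
    (hC : IsCSA (d + n) (cylinder K n)) :
    volRep (cylinder K n) hC = iterSlab (volRep K hK) n :=
  integralRep_eq (by rw [iterSlab_domain K hK n]; rfl) (by rw [iterSlab_integrand _ rfl n]; rfl)

/-- **The flattening relation (2.6) is a chain of Newton–Leibniz moves (3).**
[cite: CressonViusos2022, §2.2 (2.6)] -/
theorem toKZ_mem_relations_of_mem_flatteningRel {x : GKZGroup} (hx : x ∈ flatteningRel) :
    toKZ x ∈ relations := by
  obtain ⟨d, n, K, hK, hC, rfl⟩ := hx
  rw [map_sub, toKZ_csaOf, toKZ_csaOf, volRep_cylinder_eq_iterSlab K hK n hC]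
  exact (equivalent_iterSlab (volRep K hK) n).symm

/-- **The GKZ-rules are compatible with the KZ-rules** [Cresson–Viu-Sos 2022, p. 326]: `toKZ` maps
the relations of `K₀(CSA_{ℝalg})` into the relations of the KZ calculus.
[cite: CressonViusos2022, §1 p. 326 ((1.3))] -/
theorem gkzRelations_le_comap : gkzRelations ≤ relations.comap toKZ := by
  rw [gkzRelations, AddSubgroup.closure_le]
  rintro x ((hx | hx) | hx)
  · exact toKZ_mem_relations_of_mem_scissorsRel hx
  · exact toKZ_mem_relations_of_mem_volumePreservingRel hx
  · exact toKZ_mem_relations_of_mem_flatteningRel hx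

/-- **Soundness of the GKZ-rules**: every GKZ relation has total volume `0` — `vol` is well
defined on `K₀(CSA_{ℝalg})` ("We extend naturally the volume of semi-algebraic sets into a
well-defined ring morphism `vol : K₀(CSA_{ℝalg}) → ℝ`", p. 330) — since `vol = eval ∘ toKZ` and the
KZ calculus is sound (`KZ.relations_le_ker_eval_holds`). (The registry file notes this is "true …
and deliberately not proved here".) [cite: CressonViusos2022, §2.2 (p. 330)] -/
theorem gkzRelations_le_ker_gkzVol : gkzRelations ≤ gkzVol.ker := by
  intro x hx
  rw [AddMonoidHom.mem_ker, ← eval_comp_toKZ, AddMonoidHom.comp_apply]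
  exact relations_le_ker_eval_holds (gkzRelations_le_comap hx)

/-! ### (b) GKZ ⟹ the volume form of Conjecture 1 ⟹ Conjecture 1 -/

/-- **GKZ ⟹ the volume form** [Cresson–Viu-Sos 2022, §1 p. 326 with Thm. 2.1]: if `vol` is
injective on `K₀(CSA_{ℝalg})`, then two integrand-`1` representations on compact top-dimensional
domains of one `ℝ^d` with equal volumes are KZ-equivalent (for `d ≥ 1` through `toKZ`; for `d = 0`
both domains are the point). [cite: CressonViusos2022, Thm. 2.1 (p. 331) and (1.3) (p. 326)] -/
theorem volumeConjectureCompact_of_gkzConjecture (h : GKZConjecture) : volumeConjectureCompact := by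
  intro d r r' hc hi hc' hi' h1 h1' hv
  rcases Nat.eq_zero_or_pos d with rfl | hd
  · -- `d = 0`: `ℝ⁰` is one point, both domains are all of it and both integrands are `1` on it
    have hdom : ∀ s : Set (Fin 0 → ℝ), (interior s).Nonempty → s = univ := fun s hs => by
      obtain ⟨x, hx⟩ := hs
      exact eq_univ_of_forall fun y => Subsingleton.elim x y ▸ interior_subset hx
    have hr : r.domain = univ := hdom _ hi
    have hr' : r'.domain = univ := hdom _ hi'
    exact of_sub_of_mem_relations_of_eqOn (by rw [hr, hr']) fun x hx => by
      rw [h1 x hx, h1' x (by rw [hr']; exact mem_univ x)]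
  · -- `d ≥ 1`: through `K₀(CSA_{ℝalg})`
    have hK : IsCSA d r.domain := ⟨hd, hc, hi, r.isSemialgebraic_domain⟩
    have hK' : IsCSA d r'.domain := ⟨hd, hc', hi', r'.isSemialgebraic_domain⟩
    have hvol : gkzVol (csaOf r.domain hK - csaOf r'.domain hK') = 0 := by
      rw [map_sub, gkzVol_csaOf, gkzVol_csaOf, ← value_eq_volume_of_integrand_eq_one r h1,
        ← value_eq_volume_of_integrand_eq_one r' h1', hv, sub_self]
    have hrel : toKZ (csaOf r.domain hK - csaOf r'.domain hK') ∈ relations :=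
      gkzRelations_le_comap (h _ hvol)
    rw [map_sub, toKZ_csaOf, toKZ_csaOf] at hrel
    have e1 : KZ.of r - KZ.of (volRep r.domain hK) ∈ relations :=
      of_sub_of_mem_relations_of_eqOn rfl fun x hx => h1 x hx
    have e2 : KZ.of r' - KZ.of (volRep r'.domain hK') ∈ relations :=
      of_sub_of_mem_relations_of_eqOn rfl fun x hx => h1' x hx
    have : KZ.of r - KZ.of r' = (KZ.of r - KZ.of (volRep r.domain hK)) +
        (KZ.of (volRep r.domain hK) - KZ.of (volRep r'.domain hK')) -
        (KZ.of r' - KZ.of (volRep r'.domain hK')) := by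
      abel
    rw [Equivalent, this]
    exact relations.sub_mem (relations.add_mem e1 hrel) e2

/-- **Theorem 2.1 of Cresson–Viu-Sos, two-representation form: the GKZ-conjecture implies the
KZ-conjecture** `KZPeriodConjecture'` (any two integral representations with the same value are
KZ-equivalent): GKZ gives the volume form (`volumeConjectureCompact_of_gkzConjecture`), which is
equivalent to Conjecture 1 by Viu-Sos' semi-canonical reduction — in tree the discharged fact
`KZ.kzPeriodConjecture'_iff_volumeConjectureCompact_holds` over `KZ.semiCanonicalReduction_holds`
("any integral representation of a non-zero period can be algorithmically reduced to the volume of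
a compact semi-algebraic set (up to sign)", p. 331). [cite: CressonViusos2022, Thm. 2.1 (p. 331)] -/
theorem kzPeriodConjecture'_of_gkzConjecture (h : GKZConjecture) : KZPeriodConjecture' :=
  (show KZPeriodConjecture' ↔ volumeConjectureCompact from
      kzPeriodConjecture'_iff_volumeConjectureCompact_holds).mpr
    (volumeConjectureCompact_of_gkzConjecture h)

/-- **Theorem 2.1 of Cresson–Viu-Sos, kernel form**: the GKZ-conjecture implies `ker eval = relations`
for the KZ calculus (`KZKernelConjecture`, by `kzKernelConjecture_iff_kzPeriodConjecture'`).
[cite: CressonViusos2022, Thm. 2.1 (p. 331)] -/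
theorem kzKernelConjecture_of_gkzConjecture (h : GKZConjecture) : KZKernelConjecture :=
  kzKernelConjecture_iff_kzPeriodConjecture'.mpr (kzPeriodConjecture'_of_gkzConjecture h)

/-- **Theorem 2.1 of Cresson–Viu-Sos, literal form: the GKZ-conjecture implies Conjecture 1 of
Kontsevich–Zagier** as printed in [Kontsevich–Zagier 2001, §1.2] — two integral representations of
the literal shape of the §1.1 Definition (rational integrand over a `ℚ`-semialgebraic domain,
`KZ.IntegralRep.IsRational`) with the same value are connected by the moves 1), 2), 3) — verbatim
the body of the summit statement `KontsevichZagierPeriods` (`kzPeriodConjecture'_iff_isRational`).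
[cite: CressonViusos2022, Thm. 2.1 (p. 331) and (1.3) (p. 326)] -/
theorem gkzConjecture_implies_conjectureOne (h : GKZConjecture) :
    ∀ ⦃n m : ℕ⦄ (r : IntegralRep n) (r' : IntegralRep m),
      r.IsRational → r'.IsRational → r.value = r'.value → Equivalent r r' :=
  kzPeriodConjecture'_iff_isRational.mp (kzPeriodConjecture'_of_gkzConjecture h)

end CressonViuSos

end Literature.NumberTheory.Transcendental
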